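import Literature.NumberTheory.EllipticCurves.TwoVariableAnticyclotomicControl
import HarnessLib

/-!
# Control from the `ℤ_p²`-tower down to ANY anticyclotomic line through it: the restriction
# `Sel_𝔭(K_∞^{κ}, E[p^∞]) → H¹_{nr,𝔭}(K̃_∞, E[p^∞])` along `pairKer κ₁ κ₂ ≤ ker κ`, its equivariance, injectivity
# under `E(K)[p] = 0`, and the dual map `X_Gr(E/K̃_∞) ↠ X_ac(κ, γ)` (additive, surjective)
# (line `thin_comb` v3 on the WALL `AdditiveSplitIMCInclusionAtThree`, stmt-BirchSwinnertonDyer-20395; helper for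
# `stub_descent`, `--supports`; cell `pub/bsd-wall`, lead `cruxlead-20395` g3)

The tree's `TwoVariableAnticyclotomicControl.lean` treats the case where the anticyclotomic line IS the second
coordinate `κ₂` of the generator pair (restriction along `pairKer_le_right`, dual map `XGr₂.toXAc`, semilinear along
`T₁ ↦ 0`). In a 𝔭-ADAPTED frame of line `thin_comb` (v2/v3: `κ₁` = THE `ℤ_p`-line unramified outside `𝔭`,
`κ γ₁ = κ γ`, `κ γ₂ = κ γ^{p^k}`) the crux's anticyclotomic `κ` is in general NOT a coordinate (the 𝔭-line and `κ`
may share their first layer, `THIN-COMB-V2-NOTE.md`). This file redoes the Galois side for an ARBITRARY `κ` through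
the tower (`pairKer κ₁ κ₂ ≤ ker κ`), with the frame relations as hypotheses:

* `selmerAcRes` — `Sel_𝔭(K̄^{ker κ}, E[p^∞]) →+ H¹_{nr,𝔭}(K̃_∞, E[p^∞])`, `res` restricted/corestricted
  (`resOfLe_mem_datumSelmer_of_mem_selmerOver`); `selmerAcRes_conj` — `Γ_K`-equivariance;
* `conjSelmerAc_eq_of_mul_inv_mem` — `conj_{γ'} = conj_γ` on `Sel(K̄^{ker κ})` when `γ'γ⁻¹ ∈ ker κ` (inner
  automorphisms act trivially), hence **`conjSel₂_selmerAcRes_left`** (`conj_{γ₁} ∘ res = res ∘ conj_γ`) and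
  **`conjSel₂_selmerAcRes_right`** (`conj_{γ₂} ∘ res = res ∘ conj_γ^{e}` when `γ₂(γ^e)⁻¹ ∈ ker κ`);
* `selmerAcRes_injective` — injective when `E(K)[p] = 0` (inflation–restriction, `E(K̃_∞)[p^∞] = 0`);
* the dual **`XGr₂.resDual : X_Gr(E/K̃_∞) →+ X_ac^∅(κ, γ)`**, `x ↦ x ∘ res`, and **`XGr₂.resDual_surjective`**
  under `E(K)[p] = 0` (Pontryagin duality, `CharacterModule.dual_surjective_of_injective`).
Its `Λ₂ → Λ`-semilinearity along `φ_e : T₁ ↦ T, 1 + T₂ ↦ (1+T)^e` is the sequel `…DescentControlSemilinear.lean`.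

Theorems + two bodied definitions (plumbing); no named fact, no `sorry`; nothing about BSD is claimed.
References: [SkinnerUrban2014] §3.2.7–3.2.8; [GreenbergLNM1716] §3 Lemma 3.1, §4 Prop. 4.8; [Castella2018] Def. 2.2.
-/

set_option linter.dupNamespace false
set_option autoImplicit false

noncomputable section

open scoped Classical

open NumberField IsDedekindDomain Field
open Literature.NumberTheory.GaloisRepresentations Literature.NumberTheory.EllipticCurves
open Literature.NumberTheory.EllipticCurves.Castella2018 Literature.NumberTheory.EllipticCurves.TwoVariableSelmer

universe u

namespace Summit.BirchSwinnertonDyer.BirchSwinnertonDyer.Theorems.UniversalToricDescentThinComb.DescentControl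

variable {K : Type u} [Field K] [NumberField K] (W : WeierstrassCurve K) (p : ℕ) [Fact p.Prime]
  (κ₁ κ₂ κ : ZpExtension K p) (vbar : HeightOneSpectrum (𝓞 K))
  (hker : ZpExtension.pairKer κ₁ κ₂ ≤ κ.kerSubgroup)

/-! ## §1 The restriction along `pairKer κ₁ κ₂ ≤ ker κ` and its equivariance -/

/-- **The restriction `Sel_𝔭(K̄^{ker κ}, E[p^∞]) →+ H¹_{nr,𝔭}(K̃_∞, E[p^∞])`** (`𝔭 = v̄`, `Σ = ∅`) along
`Gal(K̄/K̃_∞) = pairKer κ₁ κ₂ ≤ ker κ = Gal(K̄/K_∞^{κ})`, for ANY `ℤ_p`-line `κ` of the presented `ℤ_p²`-tower: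
`resOfLe` restricted and corestricted (`resOfLe_mem_datumSelmer_of_mem_selmerOver`). The tree's
`selmerAcToUnrSelmer₂` is the case `κ = κ₂`. A bodied definition; nothing asserted.
[cite: SkinnerUrban2014, §3.2.7 (p. 23)] [cite: Castella2018, Def. 2.2 (arXiv:1704.06608 p. 5)] -/
def selmerAcRes :
    AcSelmer.selmerAc W p κ vbar ∅ →+ unrSelmer₂ κ₁ κ₂ (W.geomPrimaryTorsion p) vbar :=
  ((W.resOfLe p hker).restrict (AcSelmer.selmerAc W p κ vbar ∅)).codRestrict
    (unrSelmer₂ κ₁ κ₂ (W.geomPrimaryTorsion p) vbar)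
    fun s ↦ resOfLe_mem_datumSelmer_of_mem_selmerOver (M := W.geomPrimaryTorsion p) hker s.2

/-- Unfolding `selmerAcRes` (definitional): on the underlying `H¹` it is `resOfLe`. [cite: SkinnerUrban2014, §3.2.7 (p. 23)] -/
@[simp]
theorem coe_selmerAcRes_apply (s : AcSelmer.selmerAc W p κ vbar ∅) :
    ((selmerAcRes W p κ₁ κ₂ κ vbar hker s : unrSelmer₂ κ₁ κ₂ (W.geomPrimaryTorsion p) vbar) :
        W.subgroupH1 p (ZpExtension.pairKer κ₁ κ₂)) =
      W.resOfLe p hker s :=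
  rfl

/-- **`Γ_K`-equivariance of the restriction**: `res ∘ conj_σ = conj_σ ∘ res` (`resOfLe_comp_conjH1_holds`).
[cite: NeukirchSchmidtWingberg2008, I.§5] -/
theorem selmerAcRes_conj (σ : absoluteGaloisGroup K) (s : AcSelmer.selmerAc W p κ vbar ∅) :
    selmerAcRes W p κ₁ κ₂ κ vbar hker (AcSelmer.conjSelmerAc W p κ vbar ∅ σ s) =
      conjSel₂ κ₁ κ₂ (W.geomPrimaryTorsion p) vbar σ (selmerAcRes W p κ₁ κ₂ κ vbar hker s) := by
  apply Subtype.ext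
  rw [coe_selmerAcRes_apply, coe_conjSel₂_apply, coe_selmerAcRes_apply, AcSelmer.coe_conjSelmerAc_apply]
  exact congrArg (fun f ↦ f (s : W.subgroupH1 p κ.kerSubgroup))
    (resOfLe_comp_conjH1_holds (M := W.geomPrimaryTorsion p) hker σ)

/-- **`conj_{γ'} = conj_γ` on `Sel(K̄^{ker κ})` when `γ' γ⁻¹ ∈ ker κ`**: `γ' = (γ'γ⁻¹)·γ` and inner automorphisms
of `ker κ` act trivially on `H¹(ker κ, ·)` (`conjH1_of_mem_holds`). [cite: SerreLocalFields1979, VII.§5 Prop. 3] -/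
theorem conjSelmerAc_eq_of_mul_inv_mem {γ' γ : absoluteGaloisGroup K} (h : γ' * γ⁻¹ ∈ κ.kerSubgroup)
    (s : AcSelmer.selmerAc W p κ vbar ∅) :
    AcSelmer.conjSelmerAc W p κ vbar ∅ γ' s = AcSelmer.conjSelmerAc W p κ vbar ∅ γ s := by
  apply Subtype.ext
  rw [AcSelmer.coe_conjSelmerAc_apply, AcSelmer.coe_conjSelmerAc_apply]
  have hγ' : γ' = (γ' * γ⁻¹) * γ := by rw [inv_mul_cancel_right]
  conv_lhs => rw [hγ']
  rw [W.conjH1_mul_holds p κ.kerSubgroup, AddMonoidHom.comp_apply, W.conjH1_of_mem_holds p κ.kerSubgroup h,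
    AddMonoidHom.id_apply]

/-- Powers: `conj_γ^m = conj_{γ^m}` on `Sel(K̄^{ker κ})` (as endomorphisms applied to a class).
[cite: Castella2018, §2.1–2.2 (arXiv:1704.06608 p. 5)] -/
theorem conjSelmerAc_pow_apply (γ : absoluteGaloisGroup K) (m : ℕ) (s : AcSelmer.selmerAc W p κ vbar ∅) :
    ((AcSelmer.conjSelmerAc W p κ vbar ∅ γ) ^ m) s = AcSelmer.conjSelmerAc W p κ vbar ∅ (γ ^ m) s :=
  Subtype.ext (by rw [AcSelmer.coe_conjSelmerAc_pow_apply, AcSelmer.coe_conjSelmerAc_apply])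

variable {γ₁ γ₂ γ : absoluteGaloisGroup K}

/-- **First frame relation**: if `γ₁ γ⁻¹ ∈ ker κ` then `conj_{γ₁} ∘ res = res ∘ conj_γ` — on the image of the
restriction the first generator of the pair acts as the crux's generator `γ`.
[cite: SkinnerUrban2014, §3.2.7 (p. 23)] -/
theorem conjSel₂_selmerAcRes_left (hγ₁ : γ₁ * γ⁻¹ ∈ κ.kerSubgroup) (s : AcSelmer.selmerAc W p κ vbar ∅) :
    conjSel₂ κ₁ κ₂ (W.geomPrimaryTorsion p) vbar γ₁ (selmerAcRes W p κ₁ κ₂ κ vbar hker s) =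
      selmerAcRes W p κ₁ κ₂ κ vbar hker (AcSelmer.conjSelmerAc W p κ vbar ∅ γ s) := by
  rw [← selmerAcRes_conj, conjSelmerAc_eq_of_mul_inv_mem W p κ vbar hγ₁]

/-- **Second frame relation**: if `γ₂ (γ^e)⁻¹ ∈ ker κ` then `conj_{γ₂} ∘ res = res ∘ conj_γ^e`.
[cite: SkinnerUrban2014, §3.2.7 (p. 23)] -/
theorem conjSel₂_selmerAcRes_right {e : ℕ} (hγ₂ : γ₂ * (γ ^ e)⁻¹ ∈ κ.kerSubgroup)
    (s : AcSelmer.selmerAc W p κ vbar ∅) :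
    conjSel₂ κ₁ κ₂ (W.geomPrimaryTorsion p) vbar γ₂ (selmerAcRes W p κ₁ κ₂ κ vbar hker s) =
      selmerAcRes W p κ₁ κ₂ κ vbar hker (((AcSelmer.conjSelmerAc W p κ vbar ∅ γ) ^ e) s) := by
  rw [← selmerAcRes_conj, conjSelmerAc_eq_of_mul_inv_mem W p κ vbar hγ₂, conjSelmerAc_pow_apply]

/-- `res` intertwines `conj_{γ₁} − 1` with `conj_γ − 1`. [cite: SkinnerUrban2014, §3.2.7 (p. 23)] -/
theorem sub_one_selmerAcRes_left (hγ₁ : γ₁ * γ⁻¹ ∈ κ.kerSubgroup) (s : AcSelmer.selmerAc W p κ vbar ∅) :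
    (conjSel₂ κ₁ κ₂ (W.geomPrimaryTorsion p) vbar γ₁ - 1) (selmerAcRes W p κ₁ κ₂ κ vbar hker s) =
      selmerAcRes W p κ₁ κ₂ κ vbar hker ((AcSelmer.conjSelmerAc W p κ vbar ∅ γ - 1) s) := by
  rw [IwasawaDual.End_sub_apply, IwasawaDual.End_sub_apply, AddMonoid.End.one_apply, AddMonoid.End.one_apply,
    map_sub, conjSel₂_selmerAcRes_left W p κ₁ κ₂ κ vbar hker hγ₁]

/-- Powers of the first intertwining: `(conj_{γ₁} − 1)^n ∘ res = res ∘ (conj_γ − 1)^n`. [cite: SkinnerUrban2014, §3.2.7 (p. 23)] -/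
theorem pow_sub_one_selmerAcRes_left (hγ₁ : γ₁ * γ⁻¹ ∈ κ.kerSubgroup) (n : ℕ)
    (s : AcSelmer.selmerAc W p κ vbar ∅) :
    ((conjSel₂ κ₁ κ₂ (W.geomPrimaryTorsion p) vbar γ₁ - 1) ^ n) (selmerAcRes W p κ₁ κ₂ κ vbar hker s) =
      selmerAcRes W p κ₁ κ₂ κ vbar hker (((AcSelmer.conjSelmerAc W p κ vbar ∅ γ - 1) ^ n) s) := by
  induction n generalizing s with
  | zero => simp only [pow_zero, AddMonoid.End.one_apply]
  | succ n ih =>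
    rw [pow_succ', pow_succ', AddMonoid.End.coe_mul, AddMonoid.End.coe_mul, Function.comp_apply,
      Function.comp_apply, ih, sub_one_selmerAcRes_left W p κ₁ κ₂ κ vbar hker hγ₁]

/-- `res` intertwines `conj_{γ₂}` with `conj_γ^e`, as endomorphisms: `conj_{γ₂} ∘ res = res ∘ conj_γ^e`.
[cite: SkinnerUrban2014, §3.2.7 (p. 23)] -/
theorem conjSel₂_comp_selmerAcRes_right {e : ℕ} (hγ₂ : γ₂ * (γ ^ e)⁻¹ ∈ κ.kerSubgroup) :
    (conjSel₂ κ₁ κ₂ (W.geomPrimaryTorsion p) vbar γ₂ : AddMonoid.End _).comp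
        (selmerAcRes W p κ₁ κ₂ κ vbar hker) =
      (selmerAcRes W p κ₁ κ₂ κ vbar hker).comp ((AcSelmer.conjSelmerAc W p κ vbar ∅ γ) ^ e) :=
  AddMonoidHom.ext fun s ↦ conjSel₂_selmerAcRes_right W p κ₁ κ₂ κ vbar hker hγ₂ s

/-! ## §2 Injectivity under `E(K)[p] = 0` -/

/-- **Injectivity of the restriction** when `E(K)[p] = 0` (any generator pair): inflation–restriction with
`E(K̃_∞)[p^∞] = 0` (`fixedPoints_pairKer_geomPrimaryTorsion_eq_bot`), exactly as the tree's
`selmerAcToUnrSelmer₂_injective`. [cite: SkinnerUrban2014, Prop. 3.2.8 (p. 23)] [cite: GreenbergLNM1716, §3 Lemma 3.1] -/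
theorem selmerAcRes_injective [W.IsElliptic] (hγ : ZpExtension.IsTopGeneratorPair κ₁ κ₂ γ₁ γ₂)
    (hK : ∀ P : W.toAffine.Point, p • P = 0 → P = 0) :
    Function.Injective (selmerAcRes W p κ₁ κ₂ κ vbar hker) := by
  have hres : Function.Injective (W.resOfLe p hker) :=
    resOfLe_injective_of_forall_fixed_eq_zero hker fun _ hm ↦ W.eq_zero_of_forall_pairKer_smul_eq hγ hK hm
  intro s t hst
  apply Subtype.ext
  exact hres (congrArg (fun u : unrSelmer₂ κ₁ κ₂ (W.geomPrimaryTorsion p) vbar ↦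
    (u : W.subgroupH1 p (ZpExtension.pairKer κ₁ κ₂))) hst)

/-! ## §3 The dual map `X_Gr(E/K̃_∞) → X_ac(κ, γ)` -/

variable (γ₁ γ₂ γ)
variable [Fact (ZpExtension.IsTopGeneratorPair κ₁ κ₂ γ₁ γ₂)] [Fact (κ.IsTopGenerator γ)]

/-- **The dual control map `X_Gr(E/K̃_∞) →+ X_ac^∅(κ, γ)`, `x ↦ x ∘ res`** (additive; its semilinearity along
`φ_e` is the sequel file). A bodied definition; nothing asserted. [cite: SkinnerUrban2014, §3.2.7 and Prop. 3.2.8 (p. 23)] -/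
def resDual : W.XGr₂ p κ₁ κ₂ vbar γ₁ γ₂ →+ AcSelmer.XAc W p κ vbar ∅ γ where
  toFun x := (x : unrSelmer₂ κ₁ κ₂ (W.geomPrimaryTorsion p) vbar →+ AddCircle (1 : ℚ)).comp
    (selmerAcRes W p κ₁ κ₂ κ vbar hker)
  map_zero' := rfl
  map_add' _ _ := rfl

/-- Unfolding `resDual` (definitional): `(resDual x)(s) = x (res s)`. [cite: SkinnerUrban2014, §3.2.7 (p. 23)] -/
@[simp]
theorem resDual_apply (x : W.XGr₂ p κ₁ κ₂ vbar γ₁ γ₂) (s : AcSelmer.selmerAc W p κ vbar ∅) :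
    resDual W p κ₁ κ₂ κ vbar hker γ₁ γ₂ γ x s = x (selmerAcRes W p κ₁ κ₂ κ vbar hker s) :=
  rfl

/-- **Surjectivity of the dual control map under `E(K)[p] = 0`**: Pontryagin duality turns the injective
restriction into a surjection on character groups (`ℚ/ℤ` divisible; `CharacterModule.dual_surjective_of_injective`).
[cite: SkinnerUrban2014, Prop. 3.2.8 (p. 23)] [cite: GreenbergLNM1716, §3 Lemma 3.1] -/
theorem resDual_surjective [W.IsElliptic] (hK : ∀ P : W.toAffine.Point, p • P = 0 → P = 0) :
    Function.Surjective (resDual W p κ₁ κ₂ κ vbar hker γ₁ γ₂ γ) := by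
  intro y
  have hinj := selmerAcRes_injective W p κ₁ κ₂ κ vbar hker
    (Fact.out : ZpExtension.IsTopGeneratorPair κ₁ κ₂ γ₁ γ₂) hK
  obtain ⟨x, hx⟩ := CharacterModule.dual_surjective_of_injective
    (selmerAcRes W p κ₁ κ₂ κ vbar hker).toIntLinearMap hinj
    (y : CharacterModule (AcSelmer.selmerAc W p κ vbar ∅))
  exact ⟨(x : W.XGr₂ p κ₁ κ₂ vbar γ₁ γ₂), hx⟩

end Summit.BirchSwinnertonDyer.BirchSwinnertonDyer.Theorems.UniversalToricDescentThinComb.DescentControl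

end
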